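import Mathlib
import Summits.QuantumFields.YangMills.Theorems.BalabanUVNodesN15BackgroundPropagatorV
import HarnessLib

/-!
# Route «BalabanUVNodes» (K4 «SpineRates»), node N15 = NE2 — THE SITE-KERNEL LAYER WITH THE BACKGROUND LIVE, I: THE NEUMANN DEVICE WITH A
# DECAYING PERTURBATION AND THE EXACT INVERSE RULE — the dressed site kernel `D = (K₀ + C)⁻¹ = (1 + WC)⁻¹W` of [B9] (3.67), its (3.48)-shaped
# majorant, and its η-defect `𝔇(D′, D) = −D′·𝔇(K′, K)·D` from the operator layer's defect ALONE

Cell `pub-ymgap`, seat `pub-ymgap-dag-n15-c` (generation g5; R134 ACCELERATION SEAT, strategy s1 «first missing estimate»; HUMAN RULING D-0062; chair R424 venue;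
`bears_on: R4∕N15`).  Filed `--supports stmt-QuantumFields-20292 --as helper` (K3⁗ `SpineGivenEndpointR13Sep`; plan KEY-18 ∕ dag-lead WORDS-140; count-neutral helper).
Imports n15-b B1a `…N15BackgroundPropagatorV` (`bgPropV`, `bgPropV_fix`) and through it A1 `…N15BackgroundPropagator` (`isUnit_one_sub_toMatrix'`), the cell
record's `T4EtaRateDefect` (`idef`, `idef_inv`), `B11SectG` (`HasMaj`, `hasMaj_comp_exp`, `RowSum`), `B9SectDWeightedNeumann` (`wrow_of_exp`,
`neumann_majorant_wrow`) BY NAME; nothing in the tree is modified.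

WHY (the located hole, this seat's g0 HANDOFF §LOCATED (b), standing since 2026-08-26: «site-kernel ∕ unit-lattice layers with background live: NO PRODUCER in
tree»).  The node's statement of record is the conjunction `NE2PlusOperator ∧ NE2PlusSite 4 p ∧ NE2PlusUnit` (`YMDAG.UVSplit.N15At`); g0–g4 of this seat and
n15-a∕-b made the OPERATOR conjunct a theorem BY NAME with the background live (the constructed pair `G′(U′U) = (1 − G′V′)⁻¹G′` of (3.64) dressed by the
print's `V′(A)` of (3.52)∕(3.60)); every `N15At` face in the tree still DISPLAYS `hsite : NE2PlusSite … Ksite` for an ARBITRARY `Ksite`, and every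
`NE2PlusSite` producer in the tree is a King-model ∕ (1.66)-torus one at the one-point background.  The print's site object is the DRESSED SITE KERNEL
([Balaban1985BackgroundPropagators] p. 403, verbatim up to OCR): *«Let us consider the operator (Q′(U)G′²(U)Q′*(U))⁻¹. Its inverse can be analytically
continued to configurations U′U and has the expansion Q′(U′U)G′²(U′U)Q′*(U′U) = Q′(U)G′²(U)Q′*(U) + C(A) (3.65) … |C(A; y, y′)| ≦ O(1)α₁ …
e^{−(1∕2)δ₀d(y,y′)} (3.66) … thus the operators in the equality are invertible and an inverse of the left-hand side can be expressed by a Neumann series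
convergent for α₁ sufficiently small (3.67)»*, the `U`-member being Thm 3.2 (3.48) p. 398 *«|(Q′(U)G′²(U)Q′*(U))⁻¹(y, y′)| ≦ B₀(L^jη)^{−4}(L^{j′}η)^{−d}
e^{−δ₀d(y,y′)}»*.  THIS FILE is the abstract device: with `K₀` the `U ≡ 1` site form, `W = K₀⁻¹` its inverse (a BINDER entering through its MAJORANT only —
the printed (3.48), a uniform bound, NOT an η-rate), `K = K₀ + C` the dressed site form, the dressed site kernel is `siteInv W K₀ K := bgPropV W (K₀ − K) =
(1 + WC)⁻¹W` (n15-b B1a's Neumann object VERBATIM, now with a DECAYING perturbation letter `C ≤ R·e^{−δd}` instead of a diagonal one), and its η-defect is read off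
the EXACT INVERSE RULE `T4EtaRateDefect.idef_inv`: `𝔇(D′, D) = −D′·𝔇(K′, K)·D` — so the site layer consumes NO η-rate input beyond the dressed site FORM's
defect `𝔇(K′, K)` (the sequel `…N15BackgroundSiteWords` computes it from the operator layer's letters by Leibniz, the averaging operators intertwining EXACTLY).

CONTENTS ([folklore]: finite-dimensional linear algebra + the lineage's lemmas BY NAME; 1 def).
* §1 THE STEP WITH A DECAYING PERTURBATION: `hasMaj_stepE` (`W∘C ≤ β·R·c_r·e^{−ρ₁d}`, one (2.61) row sum), `rowSum_stepE`, `isUnit_stepE` (`1 − [W∘C]` a unit when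
  `q := β·R·c_r² < 1`), `hasMaj_bgPropE` (NEUMANN WITH DECAY for `bgPropV W C`: `≤ β(1 − q)⁻¹·e^{−ρ₂d}`, `ρ₂ + σ ≤ ρ₁`).
* §2 THE DRESSED SITE KERNEL `siteInv W K₀ K`, `siteInv_fix` ((3.67) by construction), `comp_siteInv` (`K ∘ D = 1` when `K₀ ∘ W = 1`), `siteInv_comp`
  (`D ∘ K = 1`, `mul_eq_one_comm` in finite dimension), `idef_siteInv` (THE EXACT INVERSE RULE `𝔇(D′, D) = −D′·𝔇(K′, K)·D`, transports = identity on the common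
  site lattice).
* §3 MAJORANTS: `hasMaj_siteInv` (the dressed (3.48): `D ≤ β(1 − q)⁻¹·e^{−(ρ+σ)d}` hence at any slower rate), `hasMaj_neg_comp_comp` (the sandwich), ★
  **`hasMaj_idef_siteInv`** — for letters at one rate `δ` (`W, W′ ≤ β·e^{−δd}`; `K − K₀, K′ − K₀′ ≤ R·e^{−δd}`; `𝔇(K′, K) ≤ M·e^{−δd}`), `K₀W = 1 = K₀′W′`,
  `q = βRc_r² < 1` and `ρ + 3σ ≤ δ`: `𝔇(D′, D) ≤ A·M·A·c_r²·e^{−ρd}`, `A = β(1 − q)⁻¹` — rate-small exactly when `M` is.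

HONEST FRAMING ∕ LIMITS.  MECHANISM + linear algebra over hypothesis-shaped data: `W`, `K₀`, `K`, their fine twins and all letters are BINDERS here (the sequels
construct `K₀ = QG²Q*`, `K = (Q + F₂)X²(Q* + F₂*)` from the lineage's dressed operator layer and prove the letters; `W` = the `U ≡ 1` site kernel stays a binder
of the whole site layer, entering through its uniform majorant and `K₀W = 1`).  Common site lattice for both spacings (King's pairing is the identity on the
unit lattice, [King1986] p. 664); single-scale (3.48) prefactors (`(L^jη)^{−4}(L^{j′}η)^{−d}` inert at the unit scale).  Nothing about Bałaban's `G(U)`,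
`Q(U)` of [B9] is asserted; `U ≡ 1` is the background around which `U′ = e^{iηA′}` perturbs.  NE2⁺ NOT PRINTED, NOT proved; count-neutral (typed 28∕28;
discharged count unchanged); N15 NOT discharged; one finite T⁴ at fixed ε — NOT infinite volume, NOT OS on ℝ⁴, NOT a mass gap, NOT Clay.
-/

noncomputable section

namespace Summit.QuantumFields.YangMills.BalabanUVNodes.N15.SiteLayer

open Literature.MathematicalPhysics.QuantumFieldTheory.Balaban1983to89
open Literature.MathematicalPhysics.QuantumFieldTheory.Balaban1983to89.B11SectG (BlockNorm HasMaj hasMaj_comp hasMaj_comp_exp RowSum)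
open Literature.MathematicalPhysics.QuantumFieldTheory.Balaban1983to89.T4EtaRateDefect (idef idef_inv)
open Literature.MathematicalPhysics.QuantumFieldTheory.Balaban1983to89.B9SectDWeightedNeumann (WRow wrow_of_exp neumann_majorant_wrow)
open Literature.MathematicalPhysics.QuantumFieldTheory.Balaban1983to89.B6RandomWalk (Triangle254)
open Summit.QuantumFields.YangMills.BalabanUVNodes.N15.DerivDefect (exists_const_hasMaj_ofBlocks)
open Summit.QuantumFields.YangMills.BalabanUVNodes.N15.BackgroundModel (kappa_ofBlocks)
open Summit.QuantumFields.YangMills.BalabanUVNodes.N15.BackgroundLayer (bgPropV bgPropV_fix isUnit_one_sub_toMatrix')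

/-! ## §1 The Neumann device with a decaying perturbation -/

section Neumann

variable {Y : Type} [Fintype Y] [DecidableEq Y] {g : B6.Geometry} (blkY : Y → g.Site)
variable {W C : (Y → ℝ) →ₗ[ℝ] (Y → ℝ)} {β δW R δC σ cr : ℝ}

omit [DecidableEq Y] in
/-- THE STEP `W∘C ≤ β·R·c_r·e^{−ρ₁d}` for `W ≤ β·e^{−δ_W d}`, `C ≤ R·e^{−δ_C d}`, `0 ≤ ρ₁ ≤ δ_C`, `ρ₁ + σ ≤ δ_W` (one use of the (2.61) row sum at `σ`).
[cite: Balaban1985BackgroundPropagators, (3.66)–(3.67) p.403 (shape: «C(A)(Q′(U)G′²(U)Q′*(U))⁻¹» small); Balaban1984PropagatorsII, (2.52)–(2.56) pp.232–233] -/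
theorem hasMaj_stepE (htri : Triangle254 g) (hd : ∀ a b : g.Site, 0 ≤ g.dist a b) (hrow : RowSum g σ cr) (hβ : 0 ≤ β) (hR : 0 ≤ R)
    {ρ₁ : ℝ} (hρ₁ : 0 ≤ ρ₁) (hρ₁C : ρ₁ ≤ δC) (hρ₁W : ρ₁ + σ ≤ δW)
    (hW : HasMaj (BlockNorm.ofBlocks g blkY) (BlockNorm.ofBlocks g blkY) W (fun y y' => β * Real.exp (-(δW * g.dist y y'))))
    (hC : HasMaj (BlockNorm.ofBlocks g blkY) (BlockNorm.ofBlocks g blkY) C (fun y y' => R * Real.exp (-(δC * g.dist y y')))) :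
    HasMaj (BlockNorm.ofBlocks g blkY) (BlockNorm.ofBlocks g blkY) (W ∘ₗ C) (fun y y' => β * R * cr * Real.exp (-(ρ₁ * g.dist y y'))) := by
  have key := hasMaj_comp_exp (b₁ := BlockNorm.ofBlocks g blkY) (b₂ := BlockNorm.ofBlocks g blkY) (b₃ := BlockNorm.ofBlocks g blkY)
    htri hd hrow hβ hR hρ₁ hρ₁C hρ₁W hW hC
  refine key.mono fun a b => le_of_eq ?_
  rw [kappa_ofBlocks]
  ring

omit [DecidableEq Y] in
/-- Row sums of the step majorant: `≤ β·R·c_r·c_r` (the (2.61) row sum once more, at `σ ≤ ρ₁`). [cite: Balaban1984PropagatorsII, Lemma 2.1 (2.61) p.234] -/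
theorem rowSum_stepE (hd : ∀ a b : g.Site, 0 ≤ g.dist a b) (hrow : RowSum g σ cr) {ρ₁ : ℝ} (hσρ : σ ≤ ρ₁) (hβ : 0 ≤ β) (hR : 0 ≤ R)
    (hcr : 0 ≤ cr) (y : g.Site) : ∑ y', β * R * cr * Real.exp (-(ρ₁ * g.dist y y')) ≤ β * R * cr * cr := by
  rw [← Finset.mul_sum]
  exact mul_le_mul_of_nonneg_left ((hrow.mono hd hσρ) y) (mul_nonneg (mul_nonneg hβ hR) hcr)

/-- `1 − [W∘C]` IS A UNIT when `q := β·R·c_r² < 1` (A1's sup-norm contraction `isUnit_one_sub_toMatrix'`). [cite: Balaban1985BackgroundPropagators, (3.67) p.403 («an inverse of the left-hand side can be expressed by a Neumann series convergent for α₁ sufficiently small»: mechanism)] -/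
theorem isUnit_stepE (htri : Triangle254 g) (hd : ∀ a b : g.Site, 0 ≤ g.dist a b) (hrow : RowSum g σ cr) (hσ : 0 ≤ σ) (hβ : 0 ≤ β) (hR : 0 ≤ R)
    (hcr : 0 ≤ cr) {ρ₁ : ℝ} (hσρ : σ ≤ ρ₁) (hρ₁C : ρ₁ ≤ δC) (hρ₁W : ρ₁ + σ ≤ δW)
    (hW : HasMaj (BlockNorm.ofBlocks g blkY) (BlockNorm.ofBlocks g blkY) W (fun y y' => β * Real.exp (-(δW * g.dist y y'))))
    (hC : HasMaj (BlockNorm.ofBlocks g blkY) (BlockNorm.ofBlocks g blkY) C (fun y y' => R * Real.exp (-(δC * g.dist y y'))))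
    (hq : β * R * cr * cr < 1) : IsUnit (1 - LinearMap.toMatrix' (W ∘ₗ C)) :=
  isUnit_one_sub_toMatrix' (hasMaj_stepE blkY htri hd hrow hβ hR (hσ.trans hσρ) hρ₁C hρ₁W hW hC)
    (fun _ _ => mul_nonneg (mul_nonneg (mul_nonneg hβ hR) hcr) (Real.exp_nonneg _)) (rowSum_stepE hd hrow hσρ hβ hR hcr) hq

/-- **NEUMANN WITH DECAY for a decaying perturbation**: `bgPropV W C = (1 − W∘C)⁻¹W ≤ β(1 − βRc_r²)⁻¹·e^{−ρ₂d}` for `0 ≤ ρ₂`, `ρ₂ + σ ≤ ρ₁`, the step at `ρ₁`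
as in `hasMaj_stepE`. [cite: Balaban1985BackgroundPropagators, (3.67) p.403 (mechanism); Balaban1984PropagatorsII, (2.52)–(2.56) pp.232–233] -/
theorem hasMaj_bgPropE (htri : Triangle254 g) (hd : ∀ a b : g.Site, 0 ≤ g.dist a b) (hrow : RowSum g σ cr) (hσ : 0 ≤ σ) (hβ : 0 ≤ β) (hR : 0 ≤ R)
    (hcr : 0 ≤ cr) {ρ₁ ρ₂ : ℝ} (hσρ : σ ≤ ρ₁) (hρ₁C : ρ₁ ≤ δC) (hρ₁W : ρ₁ + σ ≤ δW) (hρ₂ : 0 ≤ ρ₂) (hρ₂₁ : ρ₂ + σ ≤ ρ₁)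
    (hW : HasMaj (BlockNorm.ofBlocks g blkY) (BlockNorm.ofBlocks g blkY) W (fun y y' => β * Real.exp (-(δW * g.dist y y'))))
    (hC : HasMaj (BlockNorm.ofBlocks g blkY) (BlockNorm.ofBlocks g blkY) C (fun y y' => R * Real.exp (-(δC * g.dist y y'))))
    (hq : β * R * cr * cr < 1) :
    HasMaj (BlockNorm.ofBlocks g blkY) (BlockNorm.ofBlocks g blkY) (bgPropV W C)
      (fun y y' => β * (1 - β * R * cr * cr)⁻¹ * Real.exp (-(ρ₂ * g.dist y y'))) := by
  have hρ₁ : 0 ≤ ρ₁ := hσ.trans hσρ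
  have hρ₂W : ρ₂ ≤ δW := by linarith
  have hfix := bgPropV_fix (isUnit_stepE blkY htri hd hrow hσ hβ hR hcr hσρ hρ₁C hρ₁W hW hC hq)
  have hK := hasMaj_stepE blkY htri hd hrow hβ hR hρ₁ hρ₁C hρ₁W hW hC
  have hwrow : WRow g ρ₂ (fun y y' => β * R * cr * Real.exp (-(ρ₁ * g.dist y y'))) (β * R * cr * cr) :=
    wrow_of_exp hd hrow (mul_nonneg (mul_nonneg hβ hR) hcr) hρ₂₁
  have hS : HasMaj (BlockNorm.ofBlocks g blkY) (BlockNorm.ofBlocks g blkY) W (fun y y' => β * Real.exp (-(ρ₂ * g.dist y y'))) :=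
    hW.mono fun a b => mul_le_mul_of_nonneg_left (Real.exp_le_exp.mpr (by nlinarith [hd a b])) hβ
  obtain ⟨M₀, hM₀, hap⟩ := exists_const_hasMaj_ofBlocks (g := g) blkY blkY (bgPropV W C)
  have hq1 : (BlockNorm.ofBlocks g blkY).κ * (β * R * cr * cr) < 1 := by rw [kappa_ofBlocks, one_mul]; exact hq
  have key := neumann_majorant_wrow htri hd hρ₂ (fun _ _ => mul_nonneg (mul_nonneg (mul_nonneg hβ hR) hcr) (Real.exp_nonneg _)) hwrow hβ hM₀
    hK hS hfix hap hq1
  refine key.mono fun a b => le_of_eq ?_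
  rw [kappa_ofBlocks, one_mul]

end Neumann

/-! ## §2 The dressed site kernel and the exact inverse rule -/

section Inverse

variable {Y : Type} [Fintype Y] [DecidableEq Y]
variable {W K₀ K W' K₀' K' : (Y → ℝ) →ₗ[ℝ] (Y → ℝ)}

/-- THE DRESSED SITE KERNEL `D = (1 + WC)⁻¹W`, `C = K − K₀`, for the `U ≡ 1` inverse site kernel `W = K₀⁻¹` and the dressed site form `K` — n15-b's
Neumann object `bgPropV W (K₀ − K)`. [cite: Balaban1985BackgroundPropagators, (3.67) p.403 (shape: the inverse by a Neumann series around `(Q′G′²Q′*)⁻¹`)] -/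
def siteInv (W K₀ K : (Y → ℝ) →ₗ[ℝ] (Y → ℝ)) : (Y → ℝ) →ₗ[ℝ] (Y → ℝ) := bgPropV W (K₀ - K)

/-- (3.67) BY CONSTRUCTION: `D = W + W(K₀ − K)D` under the unit hypothesis. [cite: Balaban1985BackgroundPropagators, (3.67) p.403 (shape)] -/
theorem siteInv_fix (hunit : IsUnit (1 - LinearMap.toMatrix' (W ∘ₗ (K₀ - K)))) :
    siteInv W K₀ K = W + (W ∘ₗ (K₀ - K)) ∘ₗ siteInv W K₀ K :=
  bgPropV_fix hunit

/-- **`K ∘ D = 1`** when `K₀ ∘ W = 1`: the Neumann object inverts the dressed site form. [cite: Balaban1985BackgroundPropagators, (3.67) p.403 («the operators in the equality are invertible»: mechanism)] -/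
theorem comp_siteInv (hunit : IsUnit (1 - LinearMap.toMatrix' (W ∘ₗ (K₀ - K)))) (hKW : K₀ ∘ₗ W = LinearMap.id) :
    K ∘ₗ siteInv W K₀ K = LinearMap.id := by
  have hfix := siteInv_fix hunit
  have hKW' : ∀ u, K₀ (W u) = u := fun u => by simpa using LinearMap.congr_fun hKW u
  refine LinearMap.ext fun v => ?_
  have h1 : siteInv W K₀ K v = W v + W ((K₀ - K) (siteInv W K₀ K v)) := by
    conv_lhs => rw [hfix]
    rfl
  have h2 : K₀ (siteInv W K₀ K v) = v + (K₀ - K) (siteInv W K₀ K v) := by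
    conv_lhs => rw [h1]
    rw [map_add, hKW', hKW']
  have h4 : K (siteInv W K₀ K v) = K₀ (siteInv W K₀ K v) - (K₀ - K) (siteInv W K₀ K v) := by
    rw [LinearMap.sub_apply]
    abel
  rw [LinearMap.comp_apply, LinearMap.id_apply, h4, h2]
  abel

/-- **`D ∘ K = 1`**: a one-sided inverse of an endomorphism of the finite-dimensional space `Y → ℝ` is two-sided. [folklore] -/
theorem siteInv_comp (hunit : IsUnit (1 - LinearMap.toMatrix' (W ∘ₗ (K₀ - K)))) (hKW : K₀ ∘ₗ W = LinearMap.id) :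
    siteInv W K₀ K ∘ₗ K = LinearMap.id := by
  have h : K * siteInv W K₀ K = 1 := comp_siteInv hunit hKW
  have h' : siteInv W K₀ K * K = 1 := mul_eq_one_comm.mp h
  exact h'

/-- **THE EXACT INVERSE RULE FOR THE DRESSED SITE KERNELS** (`T4EtaRateDefect.idef_inv`, transports = the identity of the common site lattice):
`𝔇(D′, D) = D′ − D = −D′·𝔇(K′, K)·D`, `𝔇(K′, K) = K′ − K`. [folklore] -/
theorem idef_siteInv (hunit : IsUnit (1 - LinearMap.toMatrix' (W ∘ₗ (K₀ - K)))) (hunit' : IsUnit (1 - LinearMap.toMatrix' (W' ∘ₗ (K₀' - K'))))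
    (hKW : K₀ ∘ₗ W = LinearMap.id) (hKW' : K₀' ∘ₗ W' = LinearMap.id) :
    idef LinearMap.id LinearMap.id (siteInv W' K₀' K') (siteInv W K₀ K) =
      -(siteInv W' K₀' K' ∘ₗ idef LinearMap.id LinearMap.id K' K ∘ₗ siteInv W K₀ K) :=
  idef_inv LinearMap.id LinearMap.id (siteInv_comp hunit' hKW') (comp_siteInv hunit hKW)

end Inverse

/-! ## §3 Majorants: the dressed (3.48) and the η-defect of the dressed site kernels -/

section Majorants

variable {Y : Type} [Fintype Y] [DecidableEq Y] {g : B6.Geometry} (blkY : Y → g.Site) {σ cr : ℝ}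

/-- **THE DRESSED (3.48)**: with `W ≤ β·e^{−δd}`, `K − K₀ ≤ R·e^{−δd}`, `q = βRc_r² < 1` and `ρ + 2σ ≤ δ`, the dressed site kernel obeys
`D ≤ β(1 − q)⁻¹·e^{−ρd}`. [cite: Balaban1985BackgroundPropagators, Thm 3.2 (3.48) p.398 + (3.67) p.403 («The inverse satisfies Theorem 3.2»: shape)] -/
theorem hasMaj_siteInv (htri : Triangle254 g) (hd : ∀ a b : g.Site, 0 ≤ g.dist a b) (hrow : RowSum g σ cr) (hσ : 0 ≤ σ) (hcr : 0 ≤ cr)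
    {W K₀ K : (Y → ℝ) →ₗ[ℝ] (Y → ℝ)} {β R δ ρ : ℝ} (hβ : 0 ≤ β) (hR : 0 ≤ R) (hρ : 0 ≤ ρ) (hρδ : ρ + 2 * σ ≤ δ)
    (hW : HasMaj (BlockNorm.ofBlocks g blkY) (BlockNorm.ofBlocks g blkY) W (fun y y' => β * Real.exp (-(δ * g.dist y y'))))
    (hC : HasMaj (BlockNorm.ofBlocks g blkY) (BlockNorm.ofBlocks g blkY) (K - K₀) (fun y y' => R * Real.exp (-(δ * g.dist y y'))))
    (hq : β * R * cr * cr < 1) :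
    HasMaj (BlockNorm.ofBlocks g blkY) (BlockNorm.ofBlocks g blkY) (siteInv W K₀ K)
      (fun y y' => β * (1 - β * R * cr * cr)⁻¹ * Real.exp (-(ρ * g.dist y y'))) := by
  have hC' : HasMaj (BlockNorm.ofBlocks g blkY) (BlockNorm.ofBlocks g blkY) (K₀ - K) (fun y y' => R * Real.exp (-(δ * g.dist y y'))) :=
    hC.neg.congr fun μ => by rw [neg_sub]
  exact hasMaj_bgPropE blkY htri hd hrow hσ hβ hR hcr (ρ₁ := ρ + σ) (ρ₂ := ρ) (by linarith) (by linarith) (by linarith) hρ le_rfl hW hC' hq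

omit [DecidableEq Y] in
/-- THE SANDWICH: `−(D′∘T∘D) ≤ A·M·A·c_r²·e^{−ρd}` for `D, D′ ≤ A·e^{−ρ_D d}`, `T ≤ M·e^{−ρ_T d}`, `ρ + σ ≤ ρ_D`, `ρ + 2σ ≤ ρ_T` (two (2.61) row sums). [cite: Balaban1984PropagatorsII, (2.52)–(2.56) pp.232–233] -/
theorem hasMaj_neg_comp_comp (htri : Triangle254 g) (hd : ∀ a b : g.Site, 0 ≤ g.dist a b) (hrow : RowSum g σ cr) (hσ : 0 ≤ σ) (hcr : 0 ≤ cr)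
    {D D' T : (Y → ℝ) →ₗ[ℝ] (Y → ℝ)} {A M ρD ρT ρ : ℝ} (hA : 0 ≤ A) (hM : 0 ≤ M) (hρ : 0 ≤ ρ) (hρD : ρ + σ ≤ ρD) (hρT : ρ + 2 * σ ≤ ρT)
    (hD : HasMaj (BlockNorm.ofBlocks g blkY) (BlockNorm.ofBlocks g blkY) D (fun y y' => A * Real.exp (-(ρD * g.dist y y'))))
    (hD' : HasMaj (BlockNorm.ofBlocks g blkY) (BlockNorm.ofBlocks g blkY) D' (fun y y' => A * Real.exp (-(ρD * g.dist y y'))))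
    (hT : HasMaj (BlockNorm.ofBlocks g blkY) (BlockNorm.ofBlocks g blkY) T (fun y y' => M * Real.exp (-(ρT * g.dist y y')))) :
    HasMaj (BlockNorm.ofBlocks g blkY) (BlockNorm.ofBlocks g blkY) (-(D' ∘ₗ T ∘ₗ D))
      (fun y y' => A * M * A * cr * cr * Real.exp (-(ρ * g.dist y y'))) := by
  have h1 := hasMaj_comp_exp (b₁ := BlockNorm.ofBlocks g blkY) (b₂ := BlockNorm.ofBlocks g blkY) (b₃ := BlockNorm.ofBlocks g blkY)
    (ρ := ρ + σ) htri hd hrow hM hA (by linarith) (by linarith) (by linarith) hT hD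
  have h1' : HasMaj (BlockNorm.ofBlocks g blkY) (BlockNorm.ofBlocks g blkY) (T ∘ₗ D)
      (fun a b => M * A * cr * Real.exp (-((ρ + σ) * g.dist a b))) :=
    h1.mono fun a b => le_of_eq (by rw [kappa_ofBlocks]; ring)
  have h2 := hasMaj_comp_exp (b₁ := BlockNorm.ofBlocks g blkY) (b₂ := BlockNorm.ofBlocks g blkY) (b₃ := BlockNorm.ofBlocks g blkY)
    (ρ := ρ) htri hd hrow hA (mul_nonneg (mul_nonneg hM hA) hcr) hρ (by linarith) hρD hD' h1'
  refine h2.neg.mono fun a b => le_of_eq ?_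
  rw [kappa_ofBlocks]
  ring

/-- **THE η-DEFECT OF THE DRESSED SITE KERNELS** from letters at one rate `δ`: `W, W′ ≤ β·e^{−δd}` (the `U ≡ 1` site kernels of the two spacings — the
printed uniform (3.48), NOT an η-rate), `K − K₀, K′ − K₀′ ≤ R·e^{−δd}` (the dressed site form minus the `U ≡ 1` one, (3.66)-shaped), `𝔇(K′, K) ≤ M·e^{−δd}`
(the η-defect of the dressed site FORM — the one rate-small letter), `K₀W = 1 = K₀′W′`, `q = βRc_r² < 1`, `ρ + 3σ ≤ δ`:
`𝔇(D′, D) ≤ A·M·A·c_r²·e^{−ρd}`, `A = β(1 − q)⁻¹`.  NOT PRINTED (no η-rate is); the mechanism of (3.65)–(3.67) with the resolvent identity in place of a second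
Neumann argument. [cite: Balaban1985BackgroundPropagators, (3.65)–(3.67) p.403 (mechanism); Thm 3.2 (3.48) p.398 (the `U`-member's majorant)] -/
theorem hasMaj_idef_siteInv (htri : Triangle254 g) (hd : ∀ a b : g.Site, 0 ≤ g.dist a b) (hrow : RowSum g σ cr) (hσ : 0 ≤ σ) (hcr : 0 ≤ cr)
    {W K₀ K W' K₀' K' : (Y → ℝ) →ₗ[ℝ] (Y → ℝ)} {β R M δ ρ : ℝ} (hβ : 0 ≤ β) (hR : 0 ≤ R) (hM : 0 ≤ M) (hρ : 0 ≤ ρ) (hρδ : ρ + 3 * σ ≤ δ)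
    (hW : HasMaj (BlockNorm.ofBlocks g blkY) (BlockNorm.ofBlocks g blkY) W (fun y y' => β * Real.exp (-(δ * g.dist y y'))))
    (hW' : HasMaj (BlockNorm.ofBlocks g blkY) (BlockNorm.ofBlocks g blkY) W' (fun y y' => β * Real.exp (-(δ * g.dist y y'))))
    (hC : HasMaj (BlockNorm.ofBlocks g blkY) (BlockNorm.ofBlocks g blkY) (K - K₀) (fun y y' => R * Real.exp (-(δ * g.dist y y'))))
    (hC' : HasMaj (BlockNorm.ofBlocks g blkY) (BlockNorm.ofBlocks g blkY) (K' - K₀') (fun y y' => R * Real.exp (-(δ * g.dist y y'))))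
    (hDK : HasMaj (BlockNorm.ofBlocks g blkY) (BlockNorm.ofBlocks g blkY) (idef LinearMap.id LinearMap.id K' K)
      (fun y y' => M * Real.exp (-(δ * g.dist y y'))))
    (hKW : K₀ ∘ₗ W = LinearMap.id) (hKW' : K₀' ∘ₗ W' = LinearMap.id) (hq : β * R * cr * cr < 1) :
    HasMaj (BlockNorm.ofBlocks g blkY) (BlockNorm.ofBlocks g blkY) (idef LinearMap.id LinearMap.id (siteInv W' K₀' K') (siteInv W K₀ K))
      (fun y y' => β * (1 - β * R * cr * cr)⁻¹ * M * (β * (1 - β * R * cr * cr)⁻¹) * cr * cr * Real.exp (-(ρ * g.dist y y'))) := by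
  have hq' : 0 < 1 - β * R * cr * cr := by linarith
  have hA : 0 ≤ β * (1 - β * R * cr * cr)⁻¹ := mul_nonneg hβ (inv_nonneg.2 hq'.le)
  have hCn : HasMaj (BlockNorm.ofBlocks g blkY) (BlockNorm.ofBlocks g blkY) (K₀ - K) (fun y y' => R * Real.exp (-(δ * g.dist y y'))) :=
    hC.neg.congr fun μ => by rw [neg_sub]
  have hCn' : HasMaj (BlockNorm.ofBlocks g blkY) (BlockNorm.ofBlocks g blkY) (K₀' - K') (fun y y' => R * Real.exp (-(δ * g.dist y y'))) :=
    hC'.neg.congr fun μ => by rw [neg_sub]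
  have hunit := isUnit_stepE blkY htri hd hrow hσ hβ hR hcr (ρ₁ := ρ + 2 * σ) (by linarith) (by linarith) (by linarith) hW hCn hq
  have hunit' := isUnit_stepE blkY htri hd hrow hσ hβ hR hcr (ρ₁ := ρ + 2 * σ) (by linarith) (by linarith) (by linarith) hW' hCn' hq
  have hD := hasMaj_siteInv blkY htri hd hrow hσ hcr hβ hR (ρ := ρ + σ) (by linarith) (by linarith) hW hC hq
  have hD' := hasMaj_siteInv blkY htri hd hrow hσ hcr hβ hR (ρ := ρ + σ) (by linarith) (by linarith) hW' hC' hq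
  rw [idef_siteInv hunit hunit' hKW hKW']
  exact hasMaj_neg_comp_comp blkY htri hd hrow hσ hcr hA hM hρ le_rfl (by linarith) hD hD' hDK

end Majorants

end Summit.QuantumFields.YangMills.BalabanUVNodes.N15.SiteLayer

end
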